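import Mathlib
import Summits.Ventures.PercRepro2.Defs
import Summits.Ventures.PercRepro2.Harris
import Summits.Ventures.PercRepro2.CoinDefs
import Summits.Ventures.PercRepro2.CoinReverse
import Summits.Ventures.PercRepro2.CoinStarAlg
import Summits.Ventures.PercRepro2.CoinLsmCoreAlg
import Summits.Ventures.PercRepro2.CoinLsmCoreDefs
import Summits.Ventures.PercRepro2.CoinLsmCoreMass

/-!
# Row 2′DARC over a CLOSED-IN CORE with a log-supermodular cluster law, at EVERY head
(blind cell PercRepro2, night-2 g7; proofs/NIGHT2-DARC.md §30.10)

A CLOSED-IN CORE `C` of the root `s` (`ClosedInCore`, `CoinLsmCoreDefs.lean`): every arc into `C`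
comes from `C ∪ {s}`, nothing enters `s`; everything else — entries from `C ∪ {s}` into the head,
the head, the target `t` — is an arbitrary mixed system.  By the core mass decomposition every mass
of row 2′DARC is a sum over the core levels `W ⊆ C` of `ν W · A(·) · (marker data)` with
`ν W = P(S⁺ ∩ C = W)` the cluster law and `A X = P(X ∪ {s} ↛ t without the core coins)`, which is
log-supermodular by the reversed van den Berg–Kahn inequality (`vdBKC_rev`); splitting on `u ∈ W`,
`lsmCore_functional_nonneg` closes: **if the cluster law is log-supermodular, row 2′DARC holds at
`u → w` for every head** (`darc_of_lsmCore`).  Out-trees have log-supermodular cluster laws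
(`forest_trace_lsm` reversed: `CoinTreeCore.lean`); so do the chain with a shortcut
`s → a → u, s → u` and the undirected triangle `s — a — u — s` (exact checks, §30.10), while cores
with two internally disjoint routes to a marker (the square `s — p — a — q — s`) do not.
-/

namespace Summit.Ventures.PercRepro2.Coin

open Classical

section CoreMain

variable {V : Type*} {E : Type*} [Fintype V] [DecidableEq V] [Fintype E] [DecidableEq E]
  {R : Type*} [Field R] [LinearOrder R] [IsStrictOrderedRing R]
  {arcs : E → Finset (V × V)} {s : V} {C : Finset V}

/-- **THEOREM (row 2′DARC over a closed-in core whose `u`-cell is log-supermodular, every head).**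
`ClosedInCore arcs s C`, `SameEnds`, `a, b, u ∈ C`, `w ∉ C ∪ {s}`, `t ∉ C ∪ {s}`; the cluster law
`ν W = P(S⁺ ∩ C = W)` log-supermodular on the subsets of `C` CONTAINING `u` (`hν`); the two cell
masses `M₀ = Σ_{W ∌ u} ν W · P(W ∪ {s} ↛ t)`, `M' = Σ_{W ∋ u} ν W · P(W ∪ {s, w} ↛ t)`
(reachability without the core coins) positive.  Then `Φ_D({s ↛ t in D + (u → w)}) ≥ 0`.  The
`u`-absent cell needs no hypothesis: its covariance is directed BHK on `R_{t,u}` and its shift is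
the Lemma-A shift (`covC_nonneg`, `shift_avoid_more_C`). -/
theorem darc_of_uCellLsm (p : E → R) (hp : IsProbVec p) (hS : SameEnds arcs)
    (h : ClosedInCore arcs s C) {t : V} (htC : t ∉ C) (hts : t ≠ s) {a b u w : V}
    (ha : a ∈ C) (hb : b ∈ C) (hu : u ∈ C) (hws : w ≠ s) (hwC : w ∉ C)
    (hν : ∀ W W', W ⊆ C → W' ⊆ C → u ∈ W → u ∈ W' →
      prob p (coreLevel arcs s C W) * prob p (coreLevel arcs s C W') ≤
        prob p (coreLevel arcs s C (W ∩ W')) * prob p (coreLevel arcs s C (W ∪ W')))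
    (hM₀ : 0 < ∑ W ∈ C.powerset, prob p (coreLevel arcs s C W) * notMemWt u W *
      prob p (coreAvoidEvent arcs s t C W))
    (hM' : 0 < ∑ W ∈ C.powerset, prob p (coreLevel arcs s C W) * memWt u W *
      prob p (coreAvoidEvent arcs s t C (insert w W))) :
    DARC p arcs s {t} a b u w := by
  set ν : Finset V → R := fun W => prob p (coreLevel arcs s C W) with hνdef
  set A : Finset V → R := fun X => prob p (coreAvoidEvent arcs s t C X) with hA
  set x : Finset V → R := fun W => if a ∈ W then 1 else 0 with hx
  set y : Finset V → R := fun W => if b ∈ W then 1 else 0 with hy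
  set X : Config E → R := marker (R := R) arcs s a with hX
  set Y : Config E → R := marker (R := R) arcs s b with hY
  have hxc : ∀ W ⊆ C, ∀ ω ∈ coreLevel arcs s C W, X ω = x W :=
    fun W _ ω hω => marker_on_coreLevel ha hω
  have hyc : ∀ W ⊆ C, ∀ ω ∈ coreLevel arcs s C W, Y ω = y W :=
    fun W _ ω hω => marker_on_coreLevel hb hω
  have hxyc : ∀ W ⊆ C, ∀ ω ∈ coreLevel arcs s C W, (fun ω => X ω * Y ω) ω = x W * y W :=
    fun W hW ω hω => by simp only [hxc W hW ω hω, hyc W hW ω hω]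
  have h1c : ∀ W ⊆ C, ∀ ω ∈ coreLevel arcs s C W,
      (fun _ : Config E => (1 : R)) ω = (fun _ => (1 : R)) W := fun _ _ _ _ => rfl
  -- the indicator of `u ∉ S⁺` on a level
  have huc : ∀ W ⊆ C, ∀ ω ∈ coreLevel arcs s C W,
      (fwdEvent arcs s u)ᶜ.indicator (1 : Config E → R) ω = notMemWt u W := by
    intro W _ ω hω
    have hmem : ω ∈ fwdEvent arcs s u ↔ u ∈ W := by
      simp only [fwdEvent, Set.mem_setOf_eq]
      exact (mem_coreLevel.mp hω u hu).symm
    simp only [notMemWt]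
    by_cases huW : u ∈ W
    · have hn : ω ∉ (fwdEvent arcs s u)ᶜ := fun h' => h' (hmem.mpr huW)
      rw [if_pos huW, Set.indicator_of_notMem hn]
    · have hm : ω ∈ (fwdEvent arcs s u)ᶜ := fun h' => huW (hmem.mp h')
      rw [if_neg huW, Set.indicator_of_mem hm]; rfl
  have hR := h.avoid_eq_biUnion hS htC hts
  have hG := h.gate_eq_biUnion hS htC hts hu hwC hws
  have hsplitG : ∀ g : Finset V → R,
      ∑ W ∈ C.powerset, g W * (ν W * A (starTarget u w W)) =
        ∑ W ∈ C.powerset, ν W * notMemWt u W * A W * g W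
          + ∑ W ∈ C.powerset, ν W * memWt u W * A (insert w W) * g W := by
    intro g
    rw [← Finset.sum_add_distrib]
    refine Finset.sum_congr rfl fun W _ => ?_
    rw [starTarget_split u w A W]; ring
  -- the `R`-masses, the gate masses, and the `R_{t,u}`-masses
  have hPR : prob p (avoidEvent arcs s {t}) = ∑ W ∈ C.powerset, ν W * A W := by
    rw [prob_eq_massE_one, hR, h.core_mass p t (fun W => W) h1c]
    simp only [one_mul]
    rfl
  have hXR : massE p X (avoidEvent arcs s {t}) = ∑ W ∈ C.powerset, ν W * A W * x W := by
    rw [hR, h.core_mass p t (fun W => W) hxc]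
    exact Finset.sum_congr rfl fun W _ => by ring
  have hYR : massE p Y (avoidEvent arcs s {t}) = ∑ W ∈ C.powerset, ν W * A W * y W := by
    rw [hR, h.core_mass p t (fun W => W) hyc]
    exact Finset.sum_congr rfl fun W _ => by ring
  have hPG : prob p (gateEvent arcs s {t} u w) =
      ∑ W ∈ C.powerset, ν W * notMemWt u W * A W
        + ∑ W ∈ C.powerset, ν W * memWt u W * A (insert w W) := by
    rw [prob_eq_massE_one, hG, h.core_mass p t (starTarget u w) h1c, hsplitG]
    simp only [mul_one]
  have hXG : massE p X (gateEvent arcs s {t} u w) =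
      ∑ W ∈ C.powerset, ν W * notMemWt u W * A W * x W
        + ∑ W ∈ C.powerset, ν W * memWt u W * A (insert w W) * x W := by
    rw [hG, h.core_mass p t (starTarget u w) hxc, hsplitG]
  have hYG : massE p Y (gateEvent arcs s {t} u w) =
      ∑ W ∈ C.powerset, ν W * notMemWt u W * A W * y W
        + ∑ W ∈ C.powerset, ν W * memWt u W * A (insert w W) * y W := by
    rw [hG, h.core_mass p t (starTarget u w) hyc, hsplitG]
  have hXYG : massE p (fun ω => X ω * Y ω) (gateEvent arcs s {t} u w) =
      ∑ W ∈ C.powerset, ν W * notMemWt u W * A W * (x W * y W)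
        + ∑ W ∈ C.powerset, ν W * memWt u W * A (insert w W) * (x W * y W) := by
    rw [hG, h.core_mass p t (starTarget u w) hxyc, hsplitG]
  -- the `R_{t,u} = {u ∉ S⁺} ∩ R_t` masses
  have hRu : avoidEvent arcs s (insert u {t}) = (fwdEvent arcs s u)ᶜ ∩ avoidEvent arcs s {t} :=
    avoidEvent_insert arcs s u {t}
  have hPRu : prob p (avoidEvent arcs s (insert u {t})) =
      ∑ W ∈ C.powerset, ν W * notMemWt u W * A W := by
    rw [prob_eq_massE_one, hRu, massE_inter_left, hR,
      h.core_mass p t (fun W => W) (g := fun W => notMemWt u W)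
        (fun W hW ω hω => by simp only [mul_one]; exact huc W hW ω hω)]
    exact Finset.sum_congr rfl fun W _ => by ring
  have hXRu : massE p X (avoidEvent arcs s (insert u {t})) =
      ∑ W ∈ C.powerset, ν W * notMemWt u W * A W * x W := by
    rw [hRu, massE_inter_left, hR,
      h.core_mass p t (fun W => W) (g := fun W => notMemWt u W * x W)
        (fun W hW ω hω => by rw [huc W hW ω hω, hxc W hW ω hω])]
    exact Finset.sum_congr rfl fun W _ => by ring
  have hYRu : massE p Y (avoidEvent arcs s (insert u {t})) =
      ∑ W ∈ C.powerset, ν W * notMemWt u W * A W * y W := by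
    rw [hRu, massE_inter_left, hR,
      h.core_mass p t (fun W => W) (g := fun W => notMemWt u W * y W)
        (fun W hW ω hω => by rw [huc W hW ω hω, hyc W hW ω hω])]
    exact Finset.sum_congr rfl fun W _ => by ring
  have hXYRu : massE p (fun ω => X ω * Y ω) (avoidEvent arcs s (insert u {t})) =
      ∑ W ∈ C.powerset, ν W * notMemWt u W * A W * (x W * y W) := by
    rw [hRu, massE_inter_left, hR,
      h.core_mass p t (fun W => W) (g := fun W => notMemWt u W * (x W * y W))
        (fun W hW ω hω => by simp only [huc W hW ω hω, hxc W hW ω hω, hyc W hW ω hω])]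
    exact Finset.sum_congr rfl fun W _ => by ring
  -- the `u`-absent cell: directed BHK and the Lemma-A shift (theorems of the coin system)
  set μ₀ : Finset V → R := fun W => ν W * notMemWt u W * A W with hμ₀
  set μ₁ : Finset V → R := fun W => ν W * memWt u W * A W with hμ₁
  set μ' : Finset V → R := fun W => ν W * memWt u W * A (insert w W) with hμ'
  have hsplit : ∀ g : Finset V → R, ∑ W ∈ C.powerset, ν W * A W * g W =
      ∑ W ∈ C.powerset, μ₀ W * g W + ∑ W ∈ C.powerset, μ₁ W * g W := by
    intro g
    rw [← Finset.sum_add_distrib]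
    refine Finset.sum_congr rfl fun W _ => ?_
    simp only [hμ₀, hμ₁, notMemWt, memWt]
    split_ifs <;> ring
  have hsplit1 : ∑ W ∈ C.powerset, ν W * A W =
      ∑ W ∈ C.powerset, μ₀ W + ∑ W ∈ C.powerset, μ₁ W := by
    have := hsplit (fun _ => 1)
    simpa only [mul_one] using this
  have hF₀ : (∑ W ∈ C.powerset, μ₀ W * x W) * ∑ W ∈ C.powerset, μ₀ W * y W ≤
      (∑ W ∈ C.powerset, μ₀ W) * ∑ W ∈ C.powerset, μ₀ W * (x W * y W) := by
    have hc := covC_nonneg p hp hS s a b (insert u {t})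
    simp only [covC] at hc
    rw [hPRu, hXRu, hYRu, hXYRu] at hc
    linarith
  have hshx : (∑ W ∈ C.powerset, μ₀ W * x W) * ∑ W ∈ C.powerset, μ₁ W ≤
      (∑ W ∈ C.powerset, μ₀ W) * ∑ W ∈ C.powerset, μ₁ W * x W := by
    have hsh := shift_avoid_more_C p hp hS s a (U := {t}) (U' := insert u {t})
      (Finset.subset_insert _ _)
    rw [hXRu, hPR, hXR, hPRu, hsplit1, hsplit x] at hsh
    nlinarith [hsh]
  have hshy : (∑ W ∈ C.powerset, μ₀ W * y W) * ∑ W ∈ C.powerset, μ₁ W ≤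
      (∑ W ∈ C.powerset, μ₀ W) * ∑ W ∈ C.powerset, μ₁ W * y W := by
    have hsh := shift_avoid_more_C p hp hS s b (U := {t}) (U' := insert u {t})
      (Finset.subset_insert _ _)
    rw [hYRu, hPR, hYR, hPRu, hsplit1, hsplit y] at hsh
    nlinarith [hsh]
  -- the `u`-present cell: FKG and Holley from the `u`-cell log-supermodularity
  have hν0 : ∀ W ⊆ C, 0 ≤ ν W := fun W _ => prob_nonneg hp _
  have hA0 : ∀ X ⊆ insert w C, 0 ≤ A X := fun X _ => prob_nonneg hp _
  have hAlsm : ∀ X Y, X ⊆ insert w C → Y ⊆ insert w C → A X * A Y ≤ A (X ∩ Y) * A (X ∪ Y) := by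
    intro X Y _ _
    have hh := vdBKC_rev p hp (sameEnds_coreOff (C := C) hS) t ∅ ∅ (insert s X) (insert s Y)
    have hi : insert s X ∩ insert s Y = insert s (X ∩ Y) := (Finset.insert_inter_distrib X Y s).symm
    have hun : insert s X ∪ insert s Y = insert s (X ∪ Y) := (Finset.insert_union_distrib s X Y).symm
    rw [hi, hun] at hh
    simp only [hA, coreAvoidEvent]
    simpa only [Finset.notMem_empty, false_imp_iff, implies_true, Set.setOf_true, Set.univ_inter,
      Finset.empty_union] using hh
  have hx0 : ∀ W ⊆ C, 0 ≤ x W := by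
    intro W _; simp only [hx]; split_ifs <;> norm_num
  have hy0 : ∀ W ⊆ C, 0 ≤ y W := by
    intro W _; simp only [hy]; split_ifs <;> norm_num
  have hxm : ∀ W W', W ⊆ W' → W' ⊆ C → x W ≤ x W' := by
    intro W W' hWW' _; simp only [hx]
    by_cases haW : a ∈ W
    · simp [haW, hWW' haW]
    · simp only [haW, if_false]; split_ifs <;> norm_num
  have hym : ∀ W W', W ⊆ W' → W' ⊆ C → y W ≤ y W' := by
    intro W W' hWW' _; simp only [hy]
    by_cases hbW : b ∈ W
    · simp [hbW, hWW' hbW]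
    · simp only [hbW, if_false]; split_ifs <;> norm_num
  have hsub : ∀ W ⊆ C, W ⊆ insert w C := fun W hW => hW.trans (Finset.subset_insert _ _)
  have hsub' : ∀ W ⊆ C, insert w W ⊆ insert w C := fun W hW => Finset.insert_subset_insert w hW
  have hμ₁0 : ∀ W ⊆ C, 0 ≤ μ₁ W := fun W hW =>
    mul_nonneg (mul_nonneg (hν0 W hW) (memWt_nonneg u W)) (hA0 W (hsub W hW))
  have hμ'0 : ∀ W ⊆ C, 0 ≤ μ' W := fun W hW =>
    mul_nonneg (mul_nonneg (hν0 W hW) (memWt_nonneg u W)) (hA0 _ (hsub' W hW))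
  have hiw : ∀ W W' : Finset V, W ⊆ C → W ∩ insert w W' = W ∩ W' := by
    intro W W' hW
    exact Finset.inter_insert_of_notMem (fun h' => hwC (hW h'))
  have huw : ∀ W W' : Finset V, W ∪ insert w W' = insert w (W ∪ W') := fun W W' =>
    Finset.union_insert w W W'
  have hiww : ∀ W W' : Finset V, insert w W ∩ insert w W' = insert w (W ∩ W') := fun W W' =>
    (Finset.insert_inter_distrib W W' w).symm
  have huww : ∀ W W' : Finset V, insert w W ∪ insert w W' = insert w (W ∪ W') := fun W W' =>
    (Finset.insert_union_distrib w W W').symm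
  -- the `u`-cell product step
  have hstep : ∀ (f g : Finset V → Finset V) (W W' : Finset V), W ⊆ C → W' ⊆ C →
      f W ⊆ insert w C → g W' ⊆ insert w C → f W ∩ g W' = f (W ∩ W') → f W ∪ g W' = g (W ∪ W') →
      ν W * memWt u W * A (f W) * (ν W' * memWt u W' * A (g W')) ≤
        ν (W ∩ W') * memWt u (W ∩ W') * A (f (W ∩ W')) *
          (ν (W ∪ W') * memWt u (W ∪ W') * A (g (W ∪ W'))) := by
    intro f g W W' hW hW' hf hg hi hun
    by_cases huW : u ∈ W
    · by_cases huW' : u ∈ W'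
      · have h1 := hν W W' hW hW' huW huW'
        have h2 := hAlsm (f W) (g W') hf hg
        rw [hi, hun] at h2
        have hm : memWt (R := R) u W = 1 := by simp [memWt, huW]
        have hm' : memWt (R := R) u W' = 1 := by simp [memWt, huW']
        have hmi : memWt (R := R) u (W ∩ W') = 1 := by simp [memWt, huW, huW']
        have hmu : memWt (R := R) u (W ∪ W') = 1 := by simp [memWt, huW]
        rw [hm, hm', hmi, hmu]
        calc ν W * 1 * A (f W) * (ν W' * 1 * A (g W'))
            = (ν W * ν W') * (A (f W) * A (g W')) := by ring
          _ ≤ (ν (W ∩ W') * ν (W ∪ W')) * (A (f (W ∩ W')) * A (g (W ∪ W'))) := by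
              apply mul_le_mul h1 h2 (mul_nonneg (hA0 _ hf) (hA0 _ hg))
              exact mul_nonneg (hν0 _ (Finset.inter_subset_left.trans hW))
                (hν0 _ (Finset.union_subset hW hW'))
          _ = _ := by ring
      · have hm' : memWt (R := R) u W' = 0 := by simp [memWt, huW']
        rw [hm']
        simp only [mul_zero, zero_mul]
        exact mul_nonneg (mul_nonneg (mul_nonneg (hν0 _ (Finset.inter_subset_left.trans hW))
          (memWt_nonneg u _)) (hA0 _ (hi ▸ Finset.inter_subset_left.trans hf)))
          (mul_nonneg (mul_nonneg (hν0 _ (Finset.union_subset hW hW')) (memWt_nonneg u _))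
            (hA0 _ (hun ▸ Finset.union_subset hf hg)))
    · have hm : memWt (R := R) u W = 0 := by simp [memWt, huW]
      rw [hm]
      simp only [mul_zero, zero_mul]
      exact mul_nonneg (mul_nonneg (mul_nonneg (hν0 _ (Finset.inter_subset_left.trans hW))
        (memWt_nonneg u _)) (hA0 _ (hi ▸ Finset.inter_subset_left.trans hf)))
        (mul_nonneg (mul_nonneg (hν0 _ (Finset.union_subset hW hW')) (memWt_nonneg u _))
          (hA0 _ (hun ▸ Finset.union_subset hf hg)))
  have hF' : (∑ W ∈ C.powerset, μ' W * x W) * ∑ W ∈ C.powerset, μ' W * y W ≤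
      (∑ W ∈ C.powerset, μ' W) * ∑ W ∈ C.powerset, μ' W * (x W * y W) := by
    apply fkg_powerset C μ' x y hμ'0 hx0 hy0 hxm hym
    intro W W' hW hW'
    exact hstep (fun W => insert w W) (fun W => insert w W) W W' hW hW' (hsub' W hW) (hsub' W' hW')
      (hiww W W') (huww W W')
  have hH1' : ∀ z : Finset V → R, (∀ W ⊆ C, 0 ≤ z W) → (∀ W W', W ⊆ W' → W' ⊆ C → z W ≤ z W') →
      (∑ W ∈ C.powerset, μ₁ W * z W) * ∑ W ∈ C.powerset, μ' W ≤
        (∑ W ∈ C.powerset, μ₁ W) * ∑ W ∈ C.powerset, μ' W * z W := by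
    intro z hz0 hz
    apply holley_powerset C μ₁ μ' z hμ₁0 hμ'0 hz0 hz
    intro W W' hW hW'
    exact hstep id (fun W => insert w W) W W' hW hW' (hsub W hW) (hsub' W' hW') (hiw W W' hW)
      (huw W W')
  -- `M₁ > 0` (the `u`-cell `R`-mass dominates the gate mass) and the composite shift `m₀ ≤ m'`
  have hM₁ : 0 < ∑ W ∈ C.powerset, μ₁ W := by
    refine lt_of_lt_of_le hM' (Finset.sum_le_sum fun W hW => ?_)
    have hW' : W ⊆ C := Finset.mem_powerset.mp hW
    have hAle : A (insert w W) ≤ A W := by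
      simp only [hA]
      apply prob_mono hp
      intro ω hω v hv
      exact hω v (Finset.insert_subset_insert s (Finset.subset_insert w W) hv)
    exact mul_le_mul_of_nonneg_left hAle (mul_nonneg (hν0 W hW') (memWt_nonneg u W))
  have hM₀' : 0 ≤ ∑ W ∈ C.powerset, μ₀ W := Finset.sum_nonneg fun W hW =>
    mul_nonneg (mul_nonneg (hν0 W (Finset.mem_powerset.mp hW)) (notMemWt_nonneg u W))
      (hA0 W (hsub W (Finset.mem_powerset.mp hW)))
  have hM'' : 0 ≤ ∑ W ∈ C.powerset, μ' W := hM'.le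
  have hcomp : ∀ z : Finset V → R,
      (∑ W ∈ C.powerset, μ₀ W * z W) * ∑ W ∈ C.powerset, μ₁ W ≤
        (∑ W ∈ C.powerset, μ₀ W) * ∑ W ∈ C.powerset, μ₁ W * z W →
      (∑ W ∈ C.powerset, μ₁ W * z W) * ∑ W ∈ C.powerset, μ' W ≤
        (∑ W ∈ C.powerset, μ₁ W) * ∑ W ∈ C.powerset, μ' W * z W →
      (∑ W ∈ C.powerset, μ₀ W * z W) * ∑ W ∈ C.powerset, μ' W ≤
        (∑ W ∈ C.powerset, μ₀ W) * ∑ W ∈ C.powerset, μ' W * z W := by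
    intro z h1 h2
    refine le_of_mul_le_mul_right ?_ hM₁
    calc (∑ W ∈ C.powerset, μ₀ W * z W) * (∑ W ∈ C.powerset, μ' W) * ∑ W ∈ C.powerset, μ₁ W
        = ((∑ W ∈ C.powerset, μ₀ W * z W) * ∑ W ∈ C.powerset, μ₁ W) *
            ∑ W ∈ C.powerset, μ' W := by ring
      _ ≤ ((∑ W ∈ C.powerset, μ₀ W) * ∑ W ∈ C.powerset, μ₁ W * z W) *
            ∑ W ∈ C.powerset, μ' W := mul_le_mul_of_nonneg_right h1 hM''
      _ = (∑ W ∈ C.powerset, μ₀ W) *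
            ((∑ W ∈ C.powerset, μ₁ W * z W) * ∑ W ∈ C.powerset, μ' W) := by ring
      _ ≤ (∑ W ∈ C.powerset, μ₀ W) *
            ((∑ W ∈ C.powerset, μ₁ W) * ∑ W ∈ C.powerset, μ' W * z W) :=
          mul_le_mul_of_nonneg_left h2 hM₀'
      _ = (∑ W ∈ C.powerset, μ₀ W) * (∑ W ∈ C.powerset, μ' W * z W) *
            ∑ W ∈ C.powerset, μ₁ W := by ring
  have h0'x := hcomp x hshx (hH1' x hx0 hxm)
  have h0'y := hcomp y hshy (hH1' y hy0 hym)
  have key := star_alg (1 : R) 1 (∑ W ∈ C.powerset, μ₀ W) (∑ W ∈ C.powerset, μ₀ W * x W)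
    (∑ W ∈ C.powerset, μ₀ W * y W) (∑ W ∈ C.powerset, μ₀ W * (x W * y W))
    (∑ W ∈ C.powerset, μ₁ W) (∑ W ∈ C.powerset, μ₁ W * x W) (∑ W ∈ C.powerset, μ₁ W * y W)
    (∑ W ∈ C.powerset, μ' W) (∑ W ∈ C.powerset, μ' W * x W) (∑ W ∈ C.powerset, μ' W * y W)
    (∑ W ∈ C.powerset, μ' W * (x W * y W)) zero_le_one zero_le_one hM₀ hM' hF₀ hF'
    hshx hshy (hH1' x hx0 hxm) (hH1' y hy0 hym) h0'x h0'y
  simp only [one_mul] at key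
  unfold DARC phiC
  simp only
  rw [hPR, hXR, hYR, hPG, hXG, hYG, hXYG, hsplit1, hsplit x, hsplit y]
  exact key

/-- **Corollary: a log-supermodular cluster law** (on all subsets of `C`) gives row 2′DARC at every
head — `darc_of_uCellLsm` with the `u`-cell restriction dropped. -/
theorem darc_of_lsmCore (p : E → R) (hp : IsProbVec p) (hS : SameEnds arcs)
    (h : ClosedInCore arcs s C) {t : V} (htC : t ∉ C) (hts : t ≠ s) {a b u w : V}
    (ha : a ∈ C) (hb : b ∈ C) (hu : u ∈ C) (hws : w ≠ s) (hwC : w ∉ C)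
    (hν : ∀ W W', W ⊆ C → W' ⊆ C →
      prob p (coreLevel arcs s C W) * prob p (coreLevel arcs s C W') ≤
        prob p (coreLevel arcs s C (W ∩ W')) * prob p (coreLevel arcs s C (W ∪ W')))
    (hM₀ : 0 < ∑ W ∈ C.powerset, prob p (coreLevel arcs s C W) * notMemWt u W *
      prob p (coreAvoidEvent arcs s t C W))
    (hM' : 0 < ∑ W ∈ C.powerset, prob p (coreLevel arcs s C W) * memWt u W *
      prob p (coreAvoidEvent arcs s t C (insert w W))) :
    DARC p arcs s {t} a b u w :=
  darc_of_uCellLsm p hp hS h htC hts ha hb hu hws hwC (fun W W' hW hW' _ _ => hν W W' hW hW')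
    hM₀ hM'

/-- `darc_of_uCellLsm` with the non-degeneracy stated as event probabilities:
`P(R_{t,u}) > 0` and `P(gate ∩ {u ∈ S⁺}) > 0`. -/
theorem darc_of_uCellLsm' (p : E → R) (hp : IsProbVec p) (hS : SameEnds arcs)
    (h : ClosedInCore arcs s C) {t : V} (htC : t ∉ C) (hts : t ≠ s) {a b u w : V}
    (ha : a ∈ C) (hb : b ∈ C) (hu : u ∈ C) (hws : w ≠ s) (hwC : w ∉ C)
    (hν : ∀ W W', W ⊆ C → W' ⊆ C → u ∈ W → u ∈ W' →
      prob p (coreLevel arcs s C W) * prob p (coreLevel arcs s C W') ≤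
        prob p (coreLevel arcs s C (W ∩ W')) * prob p (coreLevel arcs s C (W ∪ W')))
    (hM₀ : 0 < prob p (avoidEvent arcs s (insert u {t})))
    (hM' : 0 < prob p (gateEvent arcs s {t} u w ∩ fwdEvent arcs s u)) :
    DARC p arcs s {t} a b u w := by
  obtain ⟨e₀, e₁⟩ := h.cell_masses p hS htC hts hu hws hwC
  rw [e₀] at hM₀
  rw [e₁] at hM'
  exact darc_of_uCellLsm p hp hS h htC hts ha hb hu hws hwC hν hM₀ hM'

end CoreMain

end Summit.Ventures.PercRepro2.Coin
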